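import Summits.BirchSwinnertonDyer.BirchSwinnertonDyer.Theorems.ByReductionTypeAtTwoAdditivePotGoodPrintFamily56b1ShaAn
import Literature.NumberTheory.EllipticCurves.BSDRootNumberSmallConductorProofs
import Literature.NumberTheory.DiophantineGeometry.ConductorExponentLeEightProofs
import Literature.NumberTheory.EllipticCurves.SzpiroLocalDataProofs
import HarnessLib

/-!
# K4 crux `AdditiveRankZeroAtTwo` (19098), children C3″ (22617) / C2″ (22616): the `56b1` Thm-1.5 road with the base
# certificate `BSD(56b1, 2)` BY PRINT (Creutz–Miller's `N < 5000` theorem) — the two numeric base records of GEN 5 discharged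

Cell `bsd-2adic`, seat `bsd-2adic-k4-w2` GEN 6 (prover, explicit unit, no kit); `--supports stmt-BirchSwinnertonDyer-22617
--as helper`. HONEST FRAMING (D-0036/D-0054): the GEN 5 road `printFamily56b1_of_thm15_certified''` (p684740) displayed, besides
the X₀(56)-optimality datum, the record `ord₂(L(56b1,1)/Ω) = −1` and the LOCAL record `ord₂ Tam(56b1) = 1`, the latter only to
manufacture Miller's `BSD(56b1, 2)` at the base. Here `BSD(56b1, 2)` is taken instead from the PRINTED computer-assisted theorem
of Creutz–Miller 2012 (Thm. 1.1; with Miller 2011, Miller–Stoll 2013, Lawson–Wuthrich 2016) «full BSD for every `E/ℚ` with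
`r_an ≤ 1` and `N < 5000`» — the tree's named fact `bsdTriple_of_analyticRank_le_one_of_conductor_lt` (bsd.S31 as printed) —
whose two hypotheses are discharged IN THE KERNEL for `56b1`:

* `N(56b1) < 5000`: `N ∣ |Δ_min| = 7168 = 2¹⁰·7` (GEN 5, `conductorNorm_C56B1_dvd`) and `f₂ ≤ 8` (Lockhart–Rosen–Silverman /
  Brumer–Kramer, the tree's PROVED `conductorExponent_le_eight_holds`), so `N ∣ 2⁸·7 = 1792` (`conductorNorm_C56B1_dvd_1792`);
  Cremona's value `N = 56` is not needed.
* `r_an(56b1) = 0`: either from the kernel's `rank 56b1(ℚ) = 0` (GEN 5 complete `2`-descents, `mordellWeilRank_C56B1`) and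
  Cremona's verification of the rank conjecture for `N < 130000` BY NAME (`analyticRank_eq_mordellWeilRank_of_conductor_lt`),
  or from modularity and the record `ord₂(L(56b1,1)/Ω) = −1` (GEN 5 `analyticRank_C56B1`), which the road needs anyway as the
  printed hypothesis of Cai–Li–Zhai Thm. 1.1/1.5.

WHAT IS PROVED (0 `def`, 0 `sorry`): `conductorNorm_C56B1_dvd_1792`, `conductorNorm_C56B1_lt_5000`; `analyticRank_C56B1_of_rank`
(print rank table + kernel rank); `bsdTriple_C56B1_print` / `bsdp_C56B1_print` (full BSD / `BSD(56b1,p)` for every prime `p`, by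
print + kernel); `bsdp_two_C56B1_print_of_L`; and the road `printFamily56b1_of_thm15_print`: BSD₂ (both K4 halves, `Ш(W)(2) = 0`,
`r_an = 0`, habitat) at every global minimal model of `56b1^{(∏Q)}` on the `2N`-split sub-family, displaying ONLY the optimal
datum (`Dt`, `hopt`) and the CLZ input record `ord₂(L(56b1,1)/Ω) = −1` (`hL`); inputs BY NAME: CLZ Thm. 1.1/1.5, ARS Thm. 2.6,
Creutz–Miller (bsd.S31), modularity, GZK. The witness member `M = 65` likewise (`printFamily56b1_witness65_print`).
Closes nothing at the `∀`-level; nothing booked; BSD is not proved by any of this.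

References: [CreutzMiller2012] Thm. 1.1; [Miller2011LMS] Thm. 1.2, Def. 1.1; [MillerStoll2012] Thm. 9.1; [LawsonWuthrich2016]
§5; [Cremona2006] rank tables; [BrumerKramer1994] Thm. 6.2; [CaiLiZhai2019] Thm. 1.1, Thm. 1.5; [AgasheRibetStein2006] Thm. 2.6.
-/

set_option autoImplicit false
set_option linter.dupNamespace false

noncomputable section

open scoped Classical

open WeierstrassCurve Literature.NumberTheory.EllipticCurves
  Literature.NumberTheory.EllipticCurves.Rank1Residual
  Literature.NumberTheory.EllipticCurves.Rank1Residual.Typed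
  Literature.NumberTheory.EllipticCurves.CaiLiZhai2019
  Literature.NumberTheory.EllipticCurves.ModularForms
  Literature.NumberTheory.EllipticCurves.AgasheRibetStein2006
  Summit.BirchSwinnertonDyer.Rank1Residual
  Summit.BirchSwinnertonDyer.Rank1Residual.X5.O1
  Summit.BirchSwinnertonDyer.Rank1Residual.P2

namespace Summit.BirchSwinnertonDyer.BirchSwinnertonDyer.Theorems.AddPotGoodPrint

/-! ## §1 `N(56b1) < 5000` in the kernel -/

/-- **`N(56b1) ∣ 2⁸·7 = 1792`**: `N ∣ |Δ_min| = 2¹⁰·7` and the exponent of the conductor at `2` is at most `8`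
(Lockhart–Rosen–Silverman / Brumer–Kramer, the tree's `conductorExponent_le_eight_holds`).
[cite: BrumerKramer1994, Thm. 6.2] [cite: SilvermanAEC2009, VIII.11] -/
theorem conductorNorm_C56B1_dvd_1792 [C56B1.IsElliptic] [C56B1.IsGloballyMinimal] : C56B1.conductorNorm ℤ ∣ 1792 := by
  set N := C56B1.conductorNorm ℤ with hN
  have hN0 : N ≠ 0 := (conductorNorm_pos_holds _).ne'
  have h7168 : N ∣ 7168 := conductorNorm_C56B1_dvd
  have hle := (Nat.factorization_le_iff_dvd hN0 (by norm_num : (7168 : ℕ) ≠ 0)).mpr h7168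
  rw [← Nat.factorization_le_iff_dvd hN0 (by norm_num : (1792 : ℕ) ≠ 0)]
  intro q
  by_cases h2 : q = 2
  · subst h2
    have h8 : N.factorization 2 ≤ 8 := by
      rw [hN, show (2 : ℕ) = ((⟨2, Nat.prime_two⟩ : Nat.Primes) : ℕ) from rfl,
        factorization_conductorNorm_primesEquiv_symm]
      exact conductorExponent_le_eight_holds _ _
    have : (1792 : ℕ).factorization 2 = 8 := by
      rw [show (1792 : ℕ) = 2 ^ 8 * 7 by norm_num, Nat.factorization_mul (by norm_num) (by norm_num),
        Finsupp.add_apply, Nat.Prime.factorization_pow Nat.prime_two, Finsupp.single_eq_same,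
        Nat.factorization_eq_zero_of_not_dvd (by norm_num)]
    rw [this]; exact h8
  · have hq := hle q
    have e7168 : (7168 : ℕ).factorization q = (1792 : ℕ).factorization q := by
      rw [show (7168 : ℕ) = 2 ^ 10 * 7 by norm_num, show (1792 : ℕ) = 2 ^ 8 * 7 by norm_num,
        Nat.factorization_mul (by norm_num) (by norm_num), Nat.factorization_mul (by norm_num) (by norm_num),
        Finsupp.add_apply, Finsupp.add_apply, Nat.Prime.factorization_pow Nat.prime_two,
        Nat.Prime.factorization_pow Nat.prime_two, Finsupp.single_apply, Finsupp.single_apply, if_neg (Ne.symm h2),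
        if_neg (Ne.symm h2)]
    rw [← e7168]; exact hq

/-- **`N(56b1) < 5000`** (indeed `≤ 1792`; Cremona: `N = 56`, not needed). [cite: BrumerKramer1994, Thm. 6.2] -/
theorem conductorNorm_C56B1_lt_5000 [C56B1.IsElliptic] [C56B1.IsGloballyMinimal] : C56B1.conductorNorm ℤ < 5000 :=
  lt_of_le_of_lt (Nat.le_of_dvd (by norm_num) conductorNorm_C56B1_dvd_1792) (by norm_num)

/-! ## §2 `r_an(56b1) = 0` from the kernel rank and Cremona's rank table; full BSD for `56b1` by print -/

/-- **`r_an(56b1) = 0` from `rank 56b1(ℚ) = 0` (KERNEL, GEN 5 `mordellWeilRank_C56B1`) and Cremona's verification of the rank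
conjecture for `N < 130000` BY NAME.** [cite: Cremona2006, rank tables] [cite: CreutzMiller2012, §1, remark following Thm. 1.1] -/
theorem analyticRank_C56B1_of_rank (hrank : analyticRank_eq_mordellWeilRank_of_conductor_lt) [C56B1.IsElliptic]
    [C56B1.IsGloballyMinimal] : C56B1.analyticRank = 0 := by
  rw [hrank C56B1 (lt_trans conductorNorm_C56B1_lt_5000 (by norm_num)), mordellWeilRank_C56B1]

/-- **Full BSD (RANK ∧ SHAFIN ∧ LEAD) for `56b1` BY PRINT** (Creutz–Miller Thm. 1.1, `N(56b1) < 5000` in the kernel), given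
`r_an(56b1) = 0`. [cite: CreutzMiller2012, Thm. 1.1] [cite: Miller2011LMS, Thm. 1.2] -/
theorem bsdTriple_C56B1_print (hCM : bsdTriple_of_analyticRank_le_one_of_conductor_lt) [C56B1.IsElliptic]
    [C56B1.IsGloballyMinimal] (hr : C56B1.analyticRank = 0) : C56B1.BSDTriple :=
  hCM C56B1 (by omega) conductorNorm_C56B1_lt_5000

/-- **Miller's `BSD(56b1, p)` for every prime `p` BY PRINT** (Creutz–Miller), given `r_an(56b1) = 0`.
[cite: CreutzMiller2012, Thm. 1.1] [cite: Miller2011LMS, §1 and Def. 1.1] -/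
theorem bsdp_C56B1_print (hCM : bsdTriple_of_analyticRank_le_one_of_conductor_lt) [C56B1.IsElliptic]
    [C56B1.IsGloballyMinimal] (hr : C56B1.analyticRank = 0) {p : ℕ} (hp : p.Prime) : BSDp C56B1 p :=
  forall_bsdp_of_bsdTriple C56B1 C56B1.tamagawaProduct_pos_holds (bsdTriple_C56B1_print hCM hr) p hp

/-- **`BSD(56b1, 2)` BY PRINT from Creutz–Miller + Cremona's rank table + the kernel rank** (no `L`-value record).
[cite: CreutzMiller2012, Thm. 1.1 and the remark following it] -/
theorem bsdp_two_C56B1_print_of_rank (hCM : bsdTriple_of_analyticRank_le_one_of_conductor_lt)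
    (hrank : analyticRank_eq_mordellWeilRank_of_conductor_lt) [C56B1.IsElliptic] [C56B1.IsGloballyMinimal] :
    BSDp C56B1 2 :=
  bsdp_C56B1_print hCM (analyticRank_C56B1_of_rank hrank) Nat.prime_two

/-- **`BSD(56b1, 2)` BY PRINT from Creutz–Miller + modularity + the record `ord₂(L(56b1,1)/Ω) = −1`** (which gives `r_an = 0`,
GEN 5 `analyticRank_C56B1`). [cite: CreutzMiller2012, Thm. 1.1] [cite: CaiLiZhai2019, §6.2.2] -/
theorem bsdp_two_C56B1_print_of_L (hCM : bsdTriple_of_analyticRank_le_one_of_conductor_lt) (hmod : hasEntireLFunction_rat)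
    [C56B1.IsElliptic] [C56B1.IsGloballyMinimal]
    (hL : ∃ q : ℚ, C56B1.entireLFunction 1 = (q : ℂ) * (C56B1.realPeriodRat : ℂ) ∧ padicValRat 2 q = -1) : BSDp C56B1 2 :=
  bsdp_C56B1_print hCM (analyticRank_C56B1 hmod hL) Nat.prime_two

/-! ## §3 The `56b1` Thm-1.5 road displaying only the optimal datum and the CLZ input record -/

/-- **BSD₂ (both K4 halves, `Ш(W)(2) = 0`) on the `2N`-split sub-family of `56b1^{(∏Q)}`** — PRINT + KERNEL + the optimal datum
(`Dt`, `hopt`) + the ONE record `ord₂(L(56b1,1)/Ω) = −1` (`hL`, the printed hypothesis of CLZ Thm. 1.1/1.5 at the base); the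
base certificate `BSD(56b1, 2)` is Creutz–Miller's theorem BY NAME (`hCM`, with `N(56b1) < 5000` and `r_an(56b1) = 0` in the
kernel / from `hL`). Kernel (GEN 5): `#E[2] = 2`, the `2`-isogeny and `Ш(E′)[2] = 0`, `rank 56b1 = 0`, `#tors = 2`, global
minimality, habitat. Inputs BY NAME: CLZ Thm. 1.1/1.5, ARS Thm. 2.6, Creutz–Miller (bsd.S31), modularity, GZK. Closes nothing at
the `∀`-level; BSD is not proved by any of this.
[cite: CaiLiZhai2019, Thm. 1.1 and Thm. 1.5] [cite: CreutzMiller2012, Thm. 1.1] [cite: AgasheRibetStein2006, Thm. 2.6]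
[cite: Miller2011LMS, Def. 1.1] -/
theorem printFamily56b1_of_thm15_print (h11 : thm11_ord_two_LAlg_twist) (h15 : thm15_twoPartBSD_twist)
    (h26 : cremona_abs_maninConstant_eq_one_of_level_le) (hCM : bsdTriple_of_analyticRank_le_one_of_conductor_lt)
    (hmod : hasEntireLFunction_rat) (hGZK : rank_eq_analyticRank_of_analyticRank_le_one)
    [C56B1.IsElliptic] [C56B1.IsGloballyMinimal] [NeZero (C56B1.conductorNorm ℤ)]
    (Dt : ModularParametrizationData C56B1 (C56B1.conductorNorm ℤ))
    (hopt : ∀ z ∈ Dt.L.lattice, ∃ w ∈ periodLattice Dt.f, z = Dt.c * w)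
    (hL : ∃ q : ℚ, C56B1.entireLFunction 1 = (q : ℂ) * (C56B1.realPeriodRat : ℂ) ∧ padicValRat 2 q = -1)
    (Q : Finset ℕ) (hQ : Q.Nonempty) (hS : ∀ q ∈ Q, InS C56B1 q)
    (hsplit : ∀ (K : Type) [Field K] [NumberField K], Module.finrank ℚ K = 2 →
      (∃ x : K, x ^ 2 = ((∏ q ∈ Q, q : ℕ) : K)) → SatisfiesHeegnerHypothesis (2 * C56B1.conductorNorm ℤ) K)
    (W : WeierstrassCurve ℚ) [W.IsElliptic] [W.IsGloballyMinimal]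
    (hW : ∃ C : VariableChange ℚ, C • C56B1.quadraticTwist ((∏ q ∈ Q, q : ℕ) : ℚ) = W) :
    W.analyticRank = 0 ∧ Addv W 2 ∧ 0 ≤ padicValRat 2 W.j ∧ ¬ W.HasCM ∧ Red W 2 ∧
      AddCommGroup.primaryComponent W.sha 2 = ⊥ ∧ BSDp W 2 ∧ MissingLowerBoundAt W 2 ∧ MissingUpperBoundAt W 2 :=
  printFamily56b1_of_thm15_certified h11 h15 h26 hmod hGZK Dt hopt hL (bsdp_two_C56B1_print_of_L hCM hmod hL) Q hQ hS
    hsplit W hW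

/-- **BSD₂ (both K4 halves, `Ш(W)(2) = 0`) at every global minimal model of `56b1^{(65)}`** (the `2N`-split witness member of
GEN 5, `M = 65`), displaying only the optimal datum and the CLZ input record; base certificate by print (Creutz–Miller).
[cite: CaiLiZhai2019, Thm. 1.1 and Thm. 1.5] [cite: CreutzMiller2012, Thm. 1.1] [cite: AgasheRibetStein2006, Thm. 2.6] -/
theorem printFamily56b1_witness65_print (h11 : thm11_ord_two_LAlg_twist) (h15 : thm15_twoPartBSD_twist)
    (h26 : cremona_abs_maninConstant_eq_one_of_level_le) (hCM : bsdTriple_of_analyticRank_le_one_of_conductor_lt)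
    (hmod : hasEntireLFunction_rat) (hGZK : rank_eq_analyticRank_of_analyticRank_le_one)
    [C56B1.IsElliptic] [C56B1.IsGloballyMinimal] [NeZero (C56B1.conductorNorm ℤ)]
    (Dt : ModularParametrizationData C56B1 (C56B1.conductorNorm ℤ))
    (hopt : ∀ z ∈ Dt.L.lattice, ∃ w ∈ periodLattice Dt.f, z = Dt.c * w)
    (hL : ∃ q : ℚ, C56B1.entireLFunction 1 = (q : ℂ) * (C56B1.realPeriodRat : ℂ) ∧ padicValRat 2 q = -1)
    (W : WeierstrassCurve ℚ) [W.IsElliptic] [W.IsGloballyMinimal]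
    (hW : ∃ C : VariableChange ℚ, C • C56B1.quadraticTwist 65 = W) :
    W.analyticRank = 0 ∧ Addv W 2 ∧ 0 ≤ padicValRat 2 W.j ∧ ¬ W.HasCM ∧ Red W 2 ∧
      AddCommGroup.primaryComponent W.sha 2 = ⊥ ∧ BSDp W 2 ∧ MissingLowerBoundAt W 2 ∧ MissingUpperBoundAt W 2 :=
  printFamily56b1_witness65 h11 h15 h26 hmod hGZK Dt hopt hL (bsdp_two_C56B1_print_of_L hCM hmod hL) W hW

end Summit.BirchSwinnertonDyer.BirchSwinnertonDyer.Theorems.AddPotGoodPrint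

end
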